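import Summits.ResolutionOfSingularities.ResolutionOfSingularities.Theorems.HilbertSamuelEliminationSigmaMaxModificationsCorridor3ConfinementLocal
import Literature.AlgebraicGeometry.Resolution.BlowupReducedDimension
import Literature.AlgebraicGeometry.Resolution.BlowupSequences
import HarnessLib

/-!
# Route `HilbertSamuelElimination`, crux `SigmaMaxModificationsCorridor3`
# (stmt-ResolutionOfSingularities-19249; child of `SigmaMaxModifications` stmt-…-18506),
# line `tame_wild` v3: CONFINEMENT ladder, row C3b — the dimension of the localised top

[OURS · L1 W4.2] Row C3b of `L/w42/helpers-v3.1.lean` (CHAIN v3.1 §5, stub-1) by name: for a blow-up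
sequence `s` of a locally Noetherian scheme `Y` and `ξ : Y`, the local scheme
`W = s.top ×_Y Spec 𝒪_{Y,ξ}` has `dim W ≤ dim 𝒪_{Y,ξ}`. Proof: `W → s.top` is a (topological)
embedding onto the points `x'` with `s.comp x' ⤳ ξ` (a base change of the preimmersion
`Spec 𝒪_{Y,ξ} → Y`), so `coheight_W w ≤ coheight_{s.top} x'`; blow-ups of locally Noetherian schemes do
not raise the codimension of points (tree `IsBlowup.coheight_le_of_isLocallyNoetherian`, Matsumura
Thm. 15.5, iterated along `s`: `CentreSeq.coheight_le_coheight_comp`), so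
`coheight x' ≤ coheight (s.comp x') ≤ coheight ξ = dim 𝒪_{Y,ξ}` as `s.comp x'` generises `ξ`. With
C3c (`dim 𝒪_{Y,ξ} ≤ 2` at non-closed points of a threefold) this puts `W` in the range `dim ≤ 2` of
the printed CJS theorems. The typed signature asks for `Y/k` of finite type and reduced; only local
Noetherianity is used (`LocallyOfFiniteType g` gives it), reducedness is not. NOT a statement of any
manuscript.

## Sources

* H. Matsumura, *Commutative Ring Theory* (1986), Thm. 15.5. [Matsumura1987]
* The Stacks Project, Tags 01J7, 02IZ, 02JU. [StacksProject]
-/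

set_option linter.dupNamespace false -- mandated namespace of this single-conjunct summit

noncomputable section

open CategoryTheory CategoryTheory.Limits AlgebraicGeometry TopologicalSpace Topology Order
open Literature.AlgebraicGeometry.Resolution Literature.RingTheory.HilbertSamuel

namespace Summit.ResolutionOfSingularities.ResolutionOfSingularities.Theorems.SigmaMaxModificationsCorridor3.Helpers

universe u

/-- **Blow-up sequences do not raise the codimension of points**: `coheight x' ≤ coheight (s.comp x')`
for every point `x'` of the top of a blow-up sequence of a locally Noetherian scheme (tree
`IsBlowup.coheight_le_of_isLocallyNoetherian` at each step). [cite: Matsumura1987, Thm. 15.5] -/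
theorem CentreSeq.coheight_le_coheight_comp : ∀ {X : Scheme.{u}} [IsLocallyNoetherian X]
    (s : CentreSeq X) (x' : s.top), coheight x' ≤ coheight (s.comp.base x')
  | _, _, CentreSeq.nil _, _ => le_rfl
  | _, _, CentreSeq.cons C rest, x' => by
    haveI : IsProper (blowup.π C) := (blowup.isBlowup C).isProper
    haveI : IsLocallyNoetherian (blowup C) := LocallyOfFiniteType.isLocallyNoetherian (blowup.π C)
    show coheight x' ≤ coheight ((rest.comp ≫ blowup.π C).base x')
    rw [Scheme.Hom.comp_base, TopCat.comp_app]
    exact (CentreSeq.coheight_le_coheight_comp rest x').trans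
      ((blowup.isBlowup C).coheight_le_of_isLocallyNoetherian _)

/-- The dimension of a scheme is bounded by a bound on the coheights of its points (in `ℕ∞`).
[folklore] -/
theorem topologicalKrullDim_le_of_forall_coheight_le (S : Scheme.{u}) (n : ℕ∞)
    (h : ∀ s : S, coheight s ≤ n) : topologicalKrullDim S ≤ (n : WithBot ℕ∞) := by
  rw [show topologicalKrullDim S = krullDim S from
    krullDim_eq_of_orderIso (irreducibleSetEquivPoints (α := S)), krullDim_eq_iSup_coheight]
  exact iSup_le fun s => by exact_mod_cast h s

/-- **C3b: `dim (s.top ×_Y Spec 𝒪_{Y,ξ}) ≤ dim 𝒪_{Y,ξ}`** for a blow-up sequence `s` of a locally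
Noetherian scheme `Y` and any `ξ : Y` (the points of the local scheme are points `x'` of `s.top` with
`s.comp x' ⤳ ξ`, embedded with their specialisation order; `coheight x' ≤ coheight (s.comp x') ≤
coheight ξ = dim 𝒪_{Y,ξ}`). [OURS · L1 W4.2] row C3b of CHAIN v3.1, general form; NOT a statement of
the manuscript. [cite: Matsumura1987, Thm. 15.5] [cite: StacksProject, Tag 01J7] -/
theorem topologicalKrullDim_pullback_comp_fromSpecStalk_le {Y : Scheme.{u}} [IsLocallyNoetherian Y]
    (s : CentreSeq Y) (ξ : Y) :
    topologicalKrullDim ↑(pullback s.comp (Y.fromSpecStalk ξ)) ≤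
      ringKrullDim (Y.presheaf.stalk ξ) := by
  haveI : IsLocallyNoetherian s.top := by
    haveI : IsProper s.comp := s.isProper_comp
    exact LocallyOfFiniteType.isLocallyNoetherian s.comp
  rw [ringKrullDim_stalk_eq_coheight]
  refine topologicalKrullDim_le_of_forall_coheight_le _ _ fun w => ?_
  let pr := pullback.fst s.comp (Y.fromSpecStalk ξ)
  -- `pr` is an embedding, hence strictly monotone for the specialisation orders
  have hmono : StrictMono (fun a : ↑(pullback s.comp (Y.fromSpecStalk ξ)) => pr.base a) := by
    intro a b hab
    simp only [lt_iff_le_not_ge, Scheme.le_iff_specializes] at hab ⊢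
    refine ⟨hab.1.map pr.continuous, fun hba => hab.2 ?_⟩
    exact pr.isEmbedding.isInducing.specializes_iff.mp hba
  -- `s.comp (pr w)` generises `ξ`
  have hgen : s.comp.base (pr.base w) ⤳ ξ := by
    have hw : pr.base w ∈ Set.range (pullback.fst s.comp (Y.fromSpecStalk ξ)) := ⟨w, rfl⟩
    rw [range_pullback_fst_fromSpecStalk] at hw
    exact hw
  calc coheight w ≤ coheight (pr.base w) := coheight_le_coheight_apply_of_strictMono _ hmono w
    _ ≤ coheight (s.comp.base (pr.base w)) := CentreSeq.coheight_le_coheight_comp s _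
    _ ≤ coheight ξ := coheight_anti (Scheme.le_iff_specializes.mpr hgen)

/-- **C3b (stub-1, M): dimension of the localised top** — plan-1's typed signature
(`L/w42/helpers-v3.1.lean`) verbatim: for a blow-up sequence `s` of a reduced scheme `Y` locally of
finite type over a field and `ξ : Y`, `dim (s.top ×_Y Spec 𝒪_{Y,ξ}) ≤ dim 𝒪_{Y,ξ}`. (A special case
of `topologicalKrullDim_pullback_comp_fromSpecStalk_le`; quasi-compactness and reducedness are not
used.) With C3c: at a non-closed point of a threefold the local scheme has dimension `≤ 2`.
[OURS · L1 W4.2] row C3b of CHAIN v3.1; NOT a statement of the manuscript.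
[cite: Matsumura1987, Thm. 15.5] [cite: StacksProject, Tag 02JU] -/
theorem stub_C3b_dim_pullback_top_le
    {k : Type} [Field k] (Y : Scheme.{0}) (g : Y ⟶ Spec (.of k)) [LocallyOfFiniteType g]
    [QuasiCompact g] [IsReduced Y] (s : CentreSeq Y) (ξ : Y) :
    topologicalKrullDim ↑(pullback s.comp (Y.fromSpecStalk ξ)) ≤
      ringKrullDim (Y.presheaf.stalk ξ) := by
  haveI : IsLocallyNoetherian Y := LocallyOfFiniteType.isLocallyNoetherian g
  exact topologicalKrullDim_pullback_comp_fromSpecStalk_le s ξ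

/-- **C3b + C3c: at a non-closed point of a threefold the localised top has dimension `≤ 2`.**
[OURS · L1 W4.2] rows C3b/C3c of CHAIN v3.1; NOT a statement of the manuscript.
[cite: Matsumura1987, Thm. 15.5] [cite: StacksProject, Tag 02IZ] -/
theorem topologicalKrullDim_pullback_comp_fromSpecStalk_le_two
    {k : Type} [Field k] (Y : Scheme.{0}) (g : Y ⟶ Spec (.of k)) [LocallyOfFiniteType g]
    (hdim : topologicalKrullDim Y ≤ ((3 : ℕ) : WithBot ℕ∞)) (s : CentreSeq Y) (ξ : Y)
    (hξ : ¬ IsClosed ({ξ} : Set Y)) :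
    topologicalKrullDim ↑(pullback s.comp (Y.fromSpecStalk ξ)) ≤ ((2 : ℕ) : WithBot ℕ∞) := by
  haveI : IsLocallyNoetherian Y := LocallyOfFiniteType.isLocallyNoetherian g
  exact (topologicalKrullDim_pullback_comp_fromSpecStalk_le s ξ).trans
    (stub_C3c_ringKrullDim_stalk_le_two_of_not_isClosed Y g hdim ξ hξ)

end Summit.ResolutionOfSingularities.ResolutionOfSingularities.Theorems.SigmaMaxModificationsCorridor3.Helpers

end
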